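import Summits.Ventures.PercRepro.C025ProfileGenGeom
import Summits.Ventures.PercRepro.C025ProfileRankFourCapA
import Summits.Ventures.PercRepro.C025ProfileRankFourDemDA

/-!
# The general certificate: (Dem)(d), the per-superset facts in every rank (night-3 g8)

NIGHT3-G8-GENERAL-CERTIFICATE.md §2(d): `B` a pair with `j(B) = 2` in a simple matroid of rank `≥ 4`, `p = ρ(E∖B) ≥ 4`
(F4′), `T = cl B ∖ B` (`t ≥ 2`), `F = E ∖ cl B` (`f ≥ p − 2`). For `y ∈ F` and `z ∈ T` write `r_y = ρ(E ∖ (B ∪ y))`,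
`r_zy = ρ(E ∖ (B ∪ {z, y}))`. This module: the values of `wgn` on the three-sets (`(p+2)/p` if `r_y + 1 = p`, else `1`)
and on the four-sets (`2/(p(p−2))`, `1/(2(p−1))`, `1/(3(p−1))` by `r_zy = p−2, p−1, p`); the rank facts
`p ≤ r_y + 1 ≤ p + 1` (G1), `r_y ≤ r_zy + 1` (G2), `r_zy = r_y` when `t ≥ 3` (G3: `z ∈ cl(T ∖ z)`),
`r_zy ≤ f` when `t = 2` (G4), and `r_y ≤ f + 1` (`ρ(T ∪ (F∖y)) ≤ 2 + (f−1)`).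
-/

open scoped Matroid

namespace PercRepro

open Set Finset ThmH

section GenDemDA

variable {α : Type} [DecidableEq α] {M : Matroid α} [M.Finite]

/-- The value of `wgn` on a three-set over a pair with `j = 2` and `ρ(E∖B) ≥ 3`: `(p+2)/p` if the complement has
rank `p − 1`, else `1`. -/
theorem wgn_insert_eq_of_jB_eq_two {B : Finset α} (hBg : B ⊆ gr M) (hBc : B.card = 2) (hj : jB M B = 2)
    (hp : 3 ≤ crk M B) {y : α} (hy : y ∈ gr M \ clF M B) :
    wgn M B (insert y B) =
      (if crk M (insert y B) + 1 = crk M B then ((crk M B : ℚ) + 2) / (crk M B : ℚ) else 1) := by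
  obtain ⟨_, _, hyB, _⟩ := mem_F_facts hBg hy
  have hsd : (insert y B \ B).card = 1 := by
    rw [Finset.insert_sdiff_of_notMem _ hyB, Finset.sdiff_self, Finset.insert_empty, Finset.card_singleton]
  unfold wgn
  rw [wg_of_sdiff_card_one_of_card_two hsd hBc hp, if_neg (by rw [hj]; omega), if_neg (by rw [hj]; omega)]
  apply max_eq_right
  split_ifs
  · positivity
  · norm_num

/-- The value of `wgn` on a four-set over a pair with `j = 2` and `ρ(E∖B) ≥ 4`. -/
theorem wgn_insert_insert_eq_of_jB_eq_two {B : Finset α} (hBg : B ⊆ gr M) (hBc : B.card = 2) (hj : jB M B = 2)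
    (hp : 4 ≤ crk M B) {z y : α} (hz : z ∈ clF M B \ B) (hy : y ∈ gr M \ clF M B) :
    wgn M B (insert y (insert z B)) =
      (if crk M (insert y (insert z B)) + 2 = crk M B then 2 / ((crk M B : ℚ) * ((crk M B : ℚ) - 2))
       else if crk M (insert y (insert z B)) + 1 = crk M B then 1 / (2 * ((crk M B : ℚ) - 1))
       else if crk M (insert y (insert z B)) = crk M B then 1 / (3 * ((crk M B : ℚ) - 1)) else 0) := by
  obtain ⟨_, hyL, hyB, _⟩ := mem_F_facts hBg hy
  have hzB : z ∉ B := (Finset.mem_sdiff.1 hz).2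
  have hyz : y ≠ z := by rintro rfl; exact hyL (Finset.mem_sdiff.1 hz).1
  have hsd : (insert y (insert z B) \ B).card = 2 := by
    rw [Finset.insert_sdiff_of_notMem _ hyB, Finset.insert_sdiff_of_notMem _ hzB, Finset.sdiff_self,
      Finset.insert_empty, Finset.card_pair hyz]
  unfold wgn
  rw [wg_of_sdiff_card_two_of_card_two hsd hBc (by omega), if_neg (by rw [hj]; omega), if_pos ⟨hj, hp⟩]
  apply max_eq_right
  have hp4 : (4 : ℚ) ≤ (crk M B : ℚ) := by exact_mod_cast hp
  split_ifs
  · apply div_nonneg (by norm_num); nlinarith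
  · apply div_nonneg (by norm_num); linarith
  · apply div_nonneg (by norm_num); linarith
  · exact le_rfl

/-- (G1) `p ≤ r_y + 1`: removing one point lowers the complement rank by at most one. -/
theorem crk_le_crk_insert_add_one {B : Finset α} (hBg : B ⊆ gr M) {y : α} (hy : y ∈ gr M \ clF M B) :
    crk M B ≤ crk M (insert y B) + 1 := by
  obtain ⟨_, _, hyB, _⟩ := mem_F_facts hBg hy
  apply crk_le_crk_add_one_of_sdiff_singleton (y := y)
  rw [Finset.insert_sdiff_of_notMem _ hyB, Finset.sdiff_self, Finset.insert_empty]

/-- (G2) `r_y ≤ r_zy + 1`. -/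
theorem crk_insert_le_crk_insert_insert_add_one {B : Finset α} (hBg : B ⊆ gr M) {z y : α} (hz : z ∈ clF M B \ B)
    (hy : y ∈ gr M \ clF M B) : crk M (insert y B) ≤ crk M (insert y (insert z B)) + 1 := by
  obtain ⟨_, hyL, hyB, _⟩ := mem_F_facts hBg hy
  have hzB : z ∉ B := (Finset.mem_sdiff.1 hz).2
  have hyz : y ≠ z := by rintro rfl; exact hyL (Finset.mem_sdiff.1 hz).1
  apply crk_le_crk_add_one_of_sdiff_singleton (y := z)
  ext w
  simp only [Finset.mem_sdiff, Finset.mem_insert, Finset.mem_singleton, not_or]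
  constructor
  · rintro ⟨hw, hwy, hwB⟩
    rcases hw with rfl | rfl | hw
    · exact absurd rfl hwy
    · rfl
    · exact absurd hw hwB
  · rintro rfl
    exact ⟨Or.inr (Or.inl rfl), hyz.symm, hzB⟩

/-- `r_zy ≤ r_y` (the four-set contains the three-set). -/
theorem crk_insert_insert_le_crk_insert {B : Finset α} {z y : α} :
    crk M (insert y (insert z B)) ≤ crk M (insert y B) :=
  crk_le_crk_of_subset (Finset.insert_subset_insert _ (Finset.subset_insert _ _))

/-- (G3) when `T` has at least three points, `r_zy = r_y`: `z` lies in the closure of `T ∖ z`, which is inside the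
complement of the four-set. -/
theorem crk_insert_insert_eq_of_three_le (hsimple : ∀ T ⊆ M.E, T.encard ≤ 2 → M.Indep T) {B : Finset α}
    (hB : B ∈ Profile.Rq M 2) {z y : α} (hz : z ∈ clF M B \ B) (hy : y ∈ gr M \ clF M B)
    (hT3 : 3 ≤ (clF M B \ B).card) : crk M (insert y (insert z B)) = crk M (insert y B) := by
  have hBmem := hB
  rw [Profile.mem_Rq] at hB
  obtain ⟨hBg, hB2⟩ := hB
  obtain ⟨_, hyL, hyB, _⟩ := mem_F_facts hBg hy
  have hzB : z ∉ B := (Finset.mem_sdiff.1 hz).2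
  have hzL : z ∈ clF M B := (Finset.mem_sdiff.1 hz).1
  have hyz : y ≠ z := by rintro rfl; exact hyL hzL
  -- two points of T other than z
  have hc : 2 ≤ ((clF M B \ B).erase z).card := by rw [Finset.card_erase_of_mem hz]; omega
  obtain ⟨U, hUT, hUc⟩ := Finset.exists_subset_card_eq hc
  obtain ⟨a, b, hab, hU⟩ := Finset.card_eq_two.1 hUc
  have ha : a ∈ (clF M B \ B).erase z := hUT (by rw [hU]; exact Finset.mem_insert_self _ _)
  have hb : b ∈ (clF M B \ B).erase z := hUT (by rw [hU]; exact Finset.mem_insert_of_mem (Finset.mem_singleton_self _))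
  have hcompl := gr_sdiff_insert_insert_eq hBg hz hy
  -- a, b lie in the complement of the four-set
  have haC : a ∈ gr M \ insert y (insert z B) := by
    rw [hcompl, Finset.mem_union]; exact Or.inl ha
  have hbC : b ∈ gr M \ insert y (insert z B) := by
    rw [hcompl, Finset.mem_union]; exact Or.inl hb
  -- the line of B lies in the closure of the complement of the four-set
  have hline : ((clF M B : Finset α) : Set α) ⊆ M.closure ((gr M \ insert y (insert z B) : Finset α) : Set α) :=
    clF_subset_closure_of_two_mem hsimple hB2 hab (Finset.mem_sdiff.1 (Finset.mem_erase.1 ha).2).1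
      (Finset.mem_sdiff.1 (Finset.mem_erase.1 hb).2).1 (by exact_mod_cast haC) (by exact_mod_cast hbC)
  have hzcl : z ∈ M.closure ((gr M \ insert y (insert z B) : Finset α) : Set α) := hline hzL
  -- the complement of the three-set is the complement of the four-set plus z
  have hceq : gr M \ insert y B = insert z (gr M \ insert y (insert z B)) := by
    ext w
    simp only [Finset.mem_sdiff, Finset.mem_insert, not_or]
    constructor
    · rintro ⟨hw, hwy, hwB⟩
      by_cases hwz : w = z
      · exact Or.inl hwz
      · exact Or.inr ⟨hw, hwy, hwz, hwB⟩
    · rintro (rfl | ⟨hw, hwy, hwz, hwB⟩)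
      · exact ⟨clF_subset_gr B hzL, hyz.symm, hzB⟩
      · exact ⟨hw, hwy, hwB⟩
  have h := eRk_insert_eq_of_mem_closure_set hzcl
  rw [← Finset.coe_insert, ← hceq, eRk_gr_sdiff_eq_crk, eRk_gr_sdiff_eq_crk] at h
  exact_mod_cast h.symm

/-- (G4) when `T` has exactly two points, `r_zy ≤ f` (the complement `{z'} ∪ (F ∖ y)` has `f` points). -/
theorem crk_insert_insert_le_card_of_two (hsimple : ∀ T ⊆ M.E, T.encard ≤ 2 → M.Indep T) {B : Finset α}
    (hB : B ∈ Profile.Rq M 2) {z y : α} (hz : z ∈ clF M B \ B) (hy : y ∈ gr M \ clF M B)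
    (hT2 : (clF M B \ B).card = 2) (hF2 : 2 ≤ (gr M \ clF M B).card) :
    crk M (insert y (insert z B)) ≤ (gr M \ clF M B).card := by
  have h := (crk_insert_insert_bounds hsimple hB hz hy (by omega) hF2).2
  rw [hT2] at h
  have : min 2 (2 - 1) = 1 := by decide
  rw [this] at h
  omega

/-- `r_y ≤ f + 1`: the complement `T ∪ (F ∖ y)` of the three-set has rank at most `2 + (f − 1)`. -/
theorem crk_insert_le_card_add_one {B : Finset α} (hB : B ∈ Profile.Rq M 2) {y : α} (hy : y ∈ gr M \ clF M B)
    (hF1 : 1 ≤ (gr M \ clF M B).card) : crk M (insert y B) ≤ (gr M \ clF M B).card + 1 := by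
  rw [Profile.mem_Rq] at hB
  obtain ⟨hBg, hB2⟩ := hB
  have hcompl := gr_sdiff_insert_eq hBg hy
  have hTr : M.eRk ((clF M B \ B : Finset α) : Set α) ≤ 2 := by
    calc M.eRk ((clF M B \ B : Finset α) : Set α) ≤ M.eRk ((clF M B : Finset α) : Set α) :=
          M.eRk_mono (Finset.coe_subset.2 Finset.sdiff_subset)
      _ = 2 := eRk_clF_of_eRk_two hB2
  have hFr : M.eRk (((gr M \ clF M B).erase y : Finset α) : Set α) ≤ (((gr M \ clF M B).card - 1 : ℕ) : ℕ∞) := by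
    rw [← Finset.card_erase_of_mem hy, ← Set.encard_coe_eq_coe_finsetCard]; exact M.eRk_le_encard _
  have h : M.eRk ((gr M \ insert y B : Finset α) : Set α) ≤ 2 + (((gr M \ clF M B).card - 1 : ℕ) : ℕ∞) := by
    rw [hcompl, Finset.coe_union]
    calc M.eRk ((clF M B \ B : Finset α) ∪ ((gr M \ clF M B).erase y : Finset α) : Set α)
        ≤ M.eRk ((clF M B \ B : Finset α) : Set α) + M.eRk (((gr M \ clF M B).erase y : Finset α) : Set α) :=
          M.eRk_union_le_eRk_add_eRk _ _
      _ ≤ 2 + (((gr M \ clF M B).card - 1 : ℕ) : ℕ∞) := add_le_add hTr hFr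
  rw [eRk_gr_sdiff_eq_crk] at h
  have : crk M (insert y B) ≤ 2 + ((gr M \ clF M B).card - 1) := by exact_mod_cast h
  omega

end GenDemDA

end PercRepro
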